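import Mathlib
import HarnessLib

/-!
# The index chain of the relaxed count road: `#(G/F) = #(G/D)·#(D/F)`, `#(G/D) = #Θ(G)`, and the final arithmetic
# (crux ♭T≤ stmt-BirchSwinnertonDyer-23042, line `sigmacongruence`, stub R1 `stub_relaxedImageCount`, step (f) ASSEMBLY — bookkeeping)

Width prover `bsd-wall-utd-p1-w2` g3 under lead `bsd-wall-utd-p1` g18 (`--supports stmt-BirchSwinnertonDyer-23042`, helper).
PURE ALGEBRA (Mathlib only); THEOREMS ONLY. BSD is not proved by any of this.

Step (f) of the lead's memo (`Cruxes/DefectTransportModThreePT/Lines/sigmacongruence-relaxed-count-road.md` §2) assembles, at a deep layer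
`K_m`, with `F = KO_m(T∪∞) ≤ D = H¹_𝓓 ≤ G = KO_m(T∪V∪∞)` (relaxed Kummer Selmer groups; `D` = classes whose transport lies in `Y^S`):
`#tuples ≤ #(G/F) · D′` (`…LayerKummerProduct.exists_forall_natCard_tuples_le_pairCount`), `D′ ≤ t₁` (dual term (d)),
`#(D/F) ≤ t₂` (image count (c), `…LayerTupleReduction`), and `#(G/D) = #Θ(Φ(G)) ≤ #{realised tuples}`. This file is the bookkeeping:

* `natCard_quotient_addSubgroupOf_eq_mul` — `#(G/F) = #(G/D) · #(D/F)` for `F ≤ D ≤ G` (`relIndex_mul_relIndex`);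
* `natCard_quotient_addSubgroupOf_eq_natCard_image` — `#(G/D) = #Θ(G)` when `D ∩ G` is the kernel of an additive `Θ` on `G`;
  `natCard_quotient_addSubgroupOf_le_natCard_of_image_subset` — hence `#(G/D) ≤ #S` for any finite `S ⊇ Θ(G)`;
* `le_mul_of_index_chain` — the arithmetic: `a ≤ I₁·I₂`, `I₂ ≤ t₁`, `I₁ = g·d`, `d ≤ t₂`, `g ≤ img` ⟹ `a ≤ (t₁ t₂) · img`.

References: [GreenbergVatsal2000] §2 pp. 24–25; folklore.
-/

-- `…BirchSwinnertonDyer.BirchSwinnertonDyer…` is the problem's mandated namespace (D-0017 nested layout)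
set_option linter.dupNamespace false
set_option autoImplicit false

namespace Summit.BirchSwinnertonDyer.BirchSwinnertonDyer.Theorems.UniversalToricDescentIndexChain

variable {X : Type*} [AddCommGroup X]

/-- **`#(G/F) = #(G/D) · #(D/F)`** for nested subgroups `F ≤ D ≤ G` (indices in the `addSubgroupOf` currency; `0` if infinite).
[folklore] -/
theorem natCard_quotient_addSubgroupOf_eq_mul {F D G : AddSubgroup X} (hFD : F ≤ D) (hDG : D ≤ G) :
    Nat.card (G ⧸ F.addSubgroupOf G) = Nat.card (G ⧸ D.addSubgroupOf G) * Nat.card (D ⧸ F.addSubgroupOf D) := by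
  have h := AddSubgroup.relIndex_mul_relIndex F D G hFD hDG
  simp only [AddSubgroup.relIndex, AddSubgroup.index] at h
  rw [← h, mul_comm]

/-- **`#(G/D) = #Θ(G)`** when `x ∈ D ↔ Θ x = 0` for `x ∈ G` (first isomorphism theorem for `Θ|_G`). [folklore] -/
theorem natCard_quotient_addSubgroupOf_eq_natCard_image {T : Type*} [AddCommGroup T] (Θ : X →+ T) {D G : AddSubgroup X}
    (hD : ∀ x ∈ G, x ∈ D ↔ Θ x = 0) :
    Nat.card (G ⧸ D.addSubgroupOf G) = Nat.card (Θ '' (G : Set X)) := by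
  have hker : (Θ.comp G.subtype).ker = D.addSubgroupOf G := by
    ext x
    rw [AddMonoidHom.mem_ker, AddMonoidHom.coe_comp, Function.comp_apply, AddSubgroup.coe_subtype,
      AddSubgroup.mem_addSubgroupOf]
    exact (hD x x.2).symm
  have hset : ((Θ.comp G.subtype).range : Set T) = Θ '' (G : Set X) := by
    ext y
    simp only [AddMonoidHom.coe_range, AddMonoidHom.coe_comp, AddSubgroup.coe_subtype, Set.mem_range, Function.comp_apply,
      Set.mem_image, SetLike.mem_coe, Subtype.exists, exists_prop]
  rw [← hker, Nat.card_congr (QuotientAddGroup.quotientKerEquivRange (Θ.comp G.subtype)).toEquiv]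
  exact Nat.card_congr (Equiv.setCongr hset)

/-- Hence **`#(G/D) ≤ #S`** for every finite set `S ⊇ Θ(G)`. [folklore] -/
theorem natCard_quotient_addSubgroupOf_le_natCard_of_image_subset {T : Type*} [AddCommGroup T] (Θ : X →+ T)
    {D G : AddSubgroup X} (hD : ∀ x ∈ G, x ∈ D ↔ Θ x = 0) {S : Set T} (hS : Θ '' (G : Set X) ⊆ S) (hfin : S.Finite) :
    Nat.card (G ⧸ D.addSubgroupOf G) ≤ Nat.card S := by
  rw [natCard_quotient_addSubgroupOf_eq_natCard_image Θ hD]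
  haveI : Finite S := hfin.to_subtype
  exact Nat.card_mono hfin hS

/-- Subtype form: **`#(G/D) ≤ #{y // P y}`** when `Θ(G) ⊆ {y | P y}` and the latter is finite. [folklore] -/
theorem natCard_quotient_addSubgroupOf_le_natCard_subtype {T : Type*} [AddCommGroup T] (Θ : X →+ T)
    {D G : AddSubgroup X} (hD : ∀ x ∈ G, x ∈ D ↔ Θ x = 0) {P : T → Prop} (hP : ∀ x ∈ G, P (Θ x))
    (hfin : {y | P y}.Finite) :
    Nat.card (G ⧸ D.addSubgroupOf G) ≤ Nat.card {y // P y} := by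
  have h := natCard_quotient_addSubgroupOf_le_natCard_of_image_subset Θ hD (S := {y | P y})
    (by rintro _ ⟨x, hx, rfl⟩; exact hP x hx) hfin
  exact h

/-- **The assembly arithmetic of step (f)**: from `a ≤ I₁·I₂` (pair count), `I₂ ≤ t₁` (dual term), `I₁ = g·d` (index chain),
`d ≤ t₂` (image count) and `g ≤ img` (realised tuples): `a ≤ (t₁·t₂)·img`. [folklore] -/
theorem le_mul_of_index_chain {a I₁ I₂ g d img t₁ t₂ : ℕ} (h1 : a ≤ I₁ * I₂) (h2 : I₂ ≤ t₁) (h3 : I₁ = g * d)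
    (h4 : d ≤ t₂) (h5 : g ≤ img) : a ≤ t₁ * t₂ * img := by
  calc a ≤ I₁ * I₂ := h1
    _ = g * d * I₂ := by rw [h3]
    _ ≤ img * t₂ * t₁ := Nat.mul_le_mul (Nat.mul_le_mul h5 h4) h2
    _ = t₁ * t₂ * img := by ring

end Summit.BirchSwinnertonDyer.BirchSwinnertonDyer.Theorems.UniversalToricDescentIndexChain
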